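import Summits.QuantumFields.BalabanUV.T4Continuum.Support.CovariantBlockReversePoincare
import Summits.QuantumFields.BalabanUV.T4Continuum.Support.VariationalColourPoincareLocal

/-!
# T⁴ programme, spine node NE2 (U1a), lane P2 — toward (GF3) WITH BACKGROUND, file 2: IN A REGULAR SMALL GAUGE THE COVARIANT LAPLACIAN IS RELATIVELY
# `Δ`-BOUNDED ON THE BLOCK-MEAN-ZERO FUNCTIONS: `‖div_R D_R k − Δ k‖² ≤ (24d·α² + 48d²·(α² + λ)²)·‖Δ k‖²` for `Q′_1 k = 0`, where `α = n·max‖R − 1‖`,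
# `λ = n²·max‖R(x,μ) − R(x−e_μ,μ)‖` (unitary `R`; model level, general finite-dimensional Hilbert `E`)

NE2 formalisation swarm `b2b-balaban-t4-ne2-formalise-*`, leaf prover 03 GEN 6 (`prover-b2b-balaban-t4-ne2-formalise-leaf-03-g6-0`); journal INTENT
CLAIMS.log 2026-08-20 «(GF3) WITH BACKGROUND IN THE REGULAR GAUGE».  On top of file 1 of «V-REG WITH BACKGROUND» (`CovariantBlockReversePoincare`:
`re_ipv_le`, `sum_nsqv_Dirv_eq_re`, p227349), leaf-09-g4's colour block Poincaré `VariationalColourPoincareLocal.nsqv_le_colour_poincare_of_blockOf` (p215xxx)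
and `VariationalColourBochner` (`Dirv`, `DirAdjv`, `negLapv`, `nsqv`, `ipv`) — BY NAME.

WHY.  The slice subspace of Bałaban's projected gauge functional is `S_R(K) = div_R D_R (K)` (leaf-09-g7, p221888).  With `S_1(K) = Δ(K)` a kernel fact at
`U = 1` ((1.90), `VariationalVectorGaugeSliceB5`), the coercivity (GF3) WITH BACKGROUND follows perturbatively once `S_R(K)` and `S_1(K)` are close; by
`SubspacePairPerturbation.oneSided_of_relBound` (file 1 of this item) that needs exactly a RELATIVE bound `‖(div_R D_R − Δ)k‖ ≤ ε‖Δk‖` on `K`.  In a REGULAR small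
gauge ([B9] (3.35)–(3.36)'s class, this lineage's `RegularBackgroundTower`: `‖R − 1‖ ≤ α/n`, lattice-Lipschitz `‖ΔR‖ ≤ λ/n²`) it holds with `ε = O(α + λ)`
UNIFORMLY in `n` (numerics: `t4/T4-EST-NE2-P2-REG.md` v1.1, kit j102549 — measured `ε ≈ 0.145·c`, n-independent, for the «sin» backgrounds).

THE MATHEMATICS ([folklore]).
 * §1 pointwise: `(div_R D_R − Δ)k (x) = Σ_μ [(1 − R(x,μ))(k(x+e_μ) − k(x)) + (1 − R(x−e_μ,μ)⋆)(k(x−e_μ) − k(x)) + ((1−R(x,μ))(1−R(x,μ))⋆ + (R(x,μ) − R(x−e_μ,μ))⋆) k(x)]`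
   (`negLapv_sub_flat_apply`, unitarity `RR⋆ = 1`), hence `‖…‖ ≤ Σ_μ [a‖D¹_μk(x)‖ + a‖D¹_μk(x−e_μ)‖ + (a² + ℓ)‖k x‖]` and
   **`nsqv_negLapv_sub_flat_le`**: `nsqv ((div_R D_R − Δ)k) ≤ 6d·a²·Σ_μ nsqv (D¹_μ k) + 3d²(a² + ℓ)²·nsqv k` (every `k`).
 * §2 on `K = ker Q′_1` (FiniteDimensional `E`): `nsqv k ≤ 4n²·Σ_μ nsqv (D¹_μ k)` (leaf-09-g4's Poincaré at flat data), `Σ_μ nsqv (D¹_μ k) = Re⟪k, Δk⟫ ≤ √nsqv k·√nsqv Δk`,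
   hence `Σ_μ nsqv (D¹_μ k) ≤ 4n²·nsqv (Δ k)` and `nsqv k ≤ 16n⁴·nsqv (Δ k)` (`dirichlet_le_of_ker`, `nsqv_le_of_ker`), and
   **`relBound_of_regular`**: `nsqv ((div_R D_R − Δ)k) ≤ (24d·(na)² + 48d²·(n²a² + n²ℓ)²)·nsqv (Δk)` for every `k ∈ ker Q′_1`.

HONEST FRAMING (T4-DAG p. 1).  Rung (B)+1 only — NOT infinite volume, NOT a mass gap, NOT Clay.  NE2 NOT IN PRINT, NOT proved here.  MODEL LEVEL: `R` DATA in
a regular gauge (c5); OURS and elementary ([folklore]); nothing printed is a hypothesis; no `def`, no `def … : Prop`, no `sorry`; axioms standard.  (GF3) with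
background is NOT proved in this file (files 3–4 of the item); V-END ∕ NE2 NOT proved; NE3 OPEN; spine PROVED 0∕9.  HONEST DEPENDENCY (cell, verbatim): continuum
YM on T⁴ ⇐ BetaPertH ∧ nine spine estimates (0/9 proved); BetaPertH ⇐ (D1) ∧ (D4) ∧ CAP+tail; G-an2-4 gates asym, D1 and NE2/3/4.
-/

noncomputable section

namespace Summit.QuantumFields.BalabanUV.T4Continuum.RegularLaplacianRelativeBound

open Finset
open scoped InnerProductSpace ComplexConjugate BigOperators
open Literature.MathematicalPhysics.QuantumFieldTheory.Balaban1983to89.B5Prop11Plancherel (Tor fine unitVec)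
open Literature.MathematicalPhysics.QuantumFieldTheory.Balaban1983to89.B5Blocks16 (blockOf)
open Summit.QuantumFields.BalabanUV.T4Continuum.VariationalColourFederbush (cDv Qcv dirUv)
open Summit.QuantumFields.BalabanUV.T4Continuum.VariationalColourBochner
  (Dirv DirAdjv negLapv nsqv nsqv_nonneg ipv ipv_self sum_sq_translate)
open Summit.QuantumFields.BalabanUV.T4Continuum.VariationalColourPoincareLocal (nsqv_le_colour_poincare_of_blockOf)
open Summit.QuantumFields.BalabanUV.T4Continuum.CovariantBlockReversePoincare (re_ipv_le sum_nsqv_Dirv_eq_re mul_le_of_sqrt_chain)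

variable {d : ℕ}
variable {E : Type*} [NormedAddCommGroup E] [InnerProductSpace ℂ E] [CompleteSpace E]

/-! ## §1 The pointwise identity and the square-sum bound (any torus, any `k`) -/

section Pointwise

variable (N : Fin d → ℕ) [∀ μ, NeZero (N μ)]


omit [∀ μ, NeZero (N μ)] in
/-- the covariant Laplacian, expanded with unitarity: `(div_R D_R k)(x) = Σ_μ [2k(x) − R(x−e_μ,μ)⋆ k(x−e_μ) − R(x,μ) k(x+e_μ)]`. [folklore] -/
theorem negLapv_apply {R : Tor N → Fin d → (E →L[ℂ] E)} (hU : ∀ x μ, R x μ ∈ unitary (E →L[ℂ] E)) (k : Tor N → E) (x : Tor N) :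
    negLapv N R k x = ∑ μ, ((2 : ℂ) • k x - star (R (x - unitVec N μ) μ) (k (x - unitVec N μ)) - R x μ (k (x + unitVec N μ))) := by
  unfold negLapv DirAdjv Dirv cDv
  refine sum_congr rfl fun μ _ => ?_
  have hx : x - unitVec N μ + unitVec N μ = x := sub_add_cancel x _
  rw [hx, map_sub, ← mul_apply_eq_comp, Unitary.star_mul_self_of_mem (hU _ μ), one_apply_eq_self, two_smul]
  abel

omit [∀ μ, NeZero (N μ)] in
/-- **THE DIFFERENCE `div_R D_R − Δ`, pointwise**, arranged as first-order terms in the flat differences plus a zeroth-order term with the SECOND-ORDER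
coefficient `(1−R)(1−R)⋆ + (R(x,μ) − R(x−e_μ,μ))⋆`. [folklore] -/
theorem negLapv_sub_flat_apply {R : Tor N → Fin d → (E →L[ℂ] E)} (hU : ∀ x μ, R x μ ∈ unitary (E →L[ℂ] E)) (k : Tor N → E) (x : Tor N) :
    negLapv N R k x - negLapv N (fun (_ : Tor N) (_ : Fin d) => (1 : E →L[ℂ] E)) k x
      = ∑ μ, ((1 - R x μ) (k (x + unitVec N μ) - k x) + (1 - star (R (x - unitVec N μ) μ)) (k (x - unitVec N μ) - k x)
          + ((1 - R x μ) * star (1 - R x μ) + star (R x μ - R (x - unitVec N μ) μ)) (k x)) := by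
  have h1 : ∀ y μ, ((fun (_ : Tor N) (_ : Fin d) => (1 : E →L[ℂ] E))) y μ ∈ unitary (E →L[ℂ] E) := fun _ _ => Submonoid.one_mem _
  rw [negLapv_apply N hU, negLapv_apply N h1, ← sum_sub_distrib]
  refine sum_congr rfl fun μ _ => ?_
  have u : R x μ * star (R x μ) = 1 := Unitary.mul_star_self_of_mem (hU x μ)
  have hu' : ∀ v, R x μ (star (R x μ) v) = v := fun v => by rw [← mul_apply_eq_comp, u, one_apply_eq_self]
  simp only [star_one, one_apply_eq_self, sub_apply, mul_apply_eq_comp, add_apply, star_sub, map_sub, hu', two_smul]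
  abel

/-- the operator-norm bounds entering: `‖(1−R)(1−R)⋆‖ ≤ a²`. [folklore] -/
theorem norm_one_sub_mul_star_le {U : E →L[ℂ] E} {a : ℝ} (ha : ‖U - 1‖ ≤ a) : ‖(1 - U) * star (1 - U)‖ ≤ a ^ 2 := by
  have h : ‖1 - U‖ ≤ a := by rw [norm_sub_rev]; exact ha
  have h0 : 0 ≤ a := (norm_nonneg _).trans h
  calc ‖(1 - U) * star (1 - U)‖ ≤ ‖1 - U‖ * ‖star (1 - U)‖ := norm_mul_le _ _
    _ = ‖1 - U‖ * ‖1 - U‖ := by rw [norm_star]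
    _ ≤ a * a := mul_le_mul h h (norm_nonneg _) h0
    _ = a ^ 2 := (sq a).symm

omit [∀ μ, NeZero (N μ)] in
/-- **pointwise bound**: `‖R − 1‖ ≤ a`, longitudinal Lipschitz `‖R(x,μ) − R(x−e_μ,μ)‖ ≤ ℓ` ⟹
`‖(div_R D_R − Δ)k (x)‖ ≤ Σ_μ [a·‖D¹_μk(x)‖ + a·‖D¹_μk(x−e_μ)‖ + (a² + ℓ)·‖k x‖]`. [folklore] -/
theorem norm_negLapv_sub_flat_le {R : Tor N → Fin d → (E →L[ℂ] E)} (hU : ∀ x μ, R x μ ∈ unitary (E →L[ℂ] E)) {a ℓ : ℝ}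
    (ha : ∀ x μ, ‖R x μ - 1‖ ≤ a) (hℓ : ∀ x μ, ‖R x μ - R (x - unitVec N μ) μ‖ ≤ ℓ) (k : Tor N → E) (x : Tor N) :
    ‖negLapv N R k x - negLapv N (fun (_ : Tor N) (_ : Fin d) => (1 : E →L[ℂ] E)) k x‖
      ≤ ∑ μ, (a * ‖Dirv N (fun (_ : Tor N) (_ : Fin d) => (1 : E →L[ℂ] E)) μ k x‖ + a * ‖Dirv N (fun (_ : Tor N) (_ : Fin d) => (1 : E →L[ℂ] E)) μ k (x - unitVec N μ)‖ + (a ^ 2 + ℓ) * ‖k x‖) := by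
  rw [negLapv_sub_flat_apply N hU]
  refine (norm_sum_le _ _).trans (sum_le_sum fun μ _ => ?_)
  have hD1 : k (x + unitVec N μ) - k x = Dirv N (fun (_ : Tor N) (_ : Fin d) => (1 : E →L[ℂ] E)) μ k x := by simp [Dirv, cDv]
  have hD2 : ‖k (x - unitVec N μ) - k x‖ = ‖Dirv N (fun (_ : Tor N) (_ : Fin d) => (1 : E →L[ℂ] E)) μ k (x - unitVec N μ)‖ := by
    rw [← norm_neg]; congr 1; simp [Dirv, cDv, sub_add_cancel]
  have n1 : ‖1 - R x μ‖ ≤ a := by rw [norm_sub_rev]; exact ha x μ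
  have n2 : ‖1 - star (R (x - unitVec N μ) μ)‖ ≤ a := by
    rw [← star_one (R := E →L[ℂ] E), ← star_sub, norm_star, norm_sub_rev]; exact ha _ μ
  have n3 : ‖(1 - R x μ) * star (1 - R x μ) + star (R x μ - R (x - unitVec N μ) μ)‖ ≤ a ^ 2 + ℓ :=
    (norm_add_le _ _).trans (add_le_add (norm_one_sub_mul_star_le (ha x μ)) (by rw [norm_star]; exact hℓ x μ))
  refine (norm_add_le _ _).trans (add_le_add ((norm_add_le _ _).trans (add_le_add ?_ ?_)) ?_)
  · rw [← hD1]; exact (ContinuousLinearMap.le_opNorm _ _).trans (mul_le_mul_of_nonneg_right n1 (norm_nonneg _))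
  · rw [← hD2]; exact (ContinuousLinearMap.le_opNorm _ _).trans (mul_le_mul_of_nonneg_right n2 (norm_nonneg _))
  · exact (ContinuousLinearMap.le_opNorm _ _).trans (mul_le_mul_of_nonneg_right n3 (norm_nonneg _))

/-- **square-sum bound**: `nsqv ((div_R D_R − Δ)k) ≤ 6d·a²·Σ_μ nsqv (D¹_μ k) + 3d²·(a² + ℓ)²·nsqv k` (every `k`). [folklore] -/
theorem nsqv_negLapv_sub_flat_le {R : Tor N → Fin d → (E →L[ℂ] E)} (hU : ∀ x μ, R x μ ∈ unitary (E →L[ℂ] E)) {a ℓ : ℝ}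
    (ha : ∀ x μ, ‖R x μ - 1‖ ≤ a) (hℓ : ∀ x μ, ‖R x μ - R (x - unitVec N μ) μ‖ ≤ ℓ) (k : Tor N → E) :
    nsqv N (negLapv N R k - negLapv N (fun (_ : Tor N) (_ : Fin d) => (1 : E →L[ℂ] E)) k)
      ≤ 6 * d * a ^ 2 * ∑ μ, nsqv N (Dirv N (fun (_ : Tor N) (_ : Fin d) => (1 : E →L[ℂ] E)) μ k) + 3 * (d : ℝ) ^ 2 * (a ^ 2 + ℓ) ^ 2 * nsqv N k := by
  have hd : (Fintype.card (Fin d) : ℝ) = d := by rw [Fintype.card_fin]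
  -- pointwise squares
  have hpt : ∀ x, ‖(negLapv N R k - negLapv N (fun (_ : Tor N) (_ : Fin d) => (1 : E →L[ℂ] E)) k) x‖ ^ 2
      ≤ 3 * d * ∑ μ, (a ^ 2 * ‖Dirv N (fun (_ : Tor N) (_ : Fin d) => (1 : E →L[ℂ] E)) μ k x‖ ^ 2 + a ^ 2 * ‖Dirv N (fun (_ : Tor N) (_ : Fin d) => (1 : E →L[ℂ] E)) μ k (x - unitVec N μ)‖ ^ 2) + 3 * (d : ℝ) ^ 2 * ((a ^ 2 + ℓ) ^ 2 * ‖k x‖ ^ 2) := by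
    intro x
    have h := norm_negLapv_sub_flat_le N hU ha hℓ k x
    have h0 : 0 ≤ ‖(negLapv N R k - negLapv N (fun (_ : Tor N) (_ : Fin d) => (1 : E →L[ℂ] E)) k) x‖ := norm_nonneg _
    have h1 := pow_le_pow_left₀ h0 h 2
    have h2 : (∑ μ, (a * ‖Dirv N (fun (_ : Tor N) (_ : Fin d) => (1 : E →L[ℂ] E)) μ k x‖ + a * ‖Dirv N (fun (_ : Tor N) (_ : Fin d) => (1 : E →L[ℂ] E)) μ k (x - unitVec N μ)‖ + (a ^ 2 + ℓ) * ‖k x‖)) ^ 2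
        ≤ d * ∑ μ, (a * ‖Dirv N (fun (_ : Tor N) (_ : Fin d) => (1 : E →L[ℂ] E)) μ k x‖ + a * ‖Dirv N (fun (_ : Tor N) (_ : Fin d) => (1 : E →L[ℂ] E)) μ k (x - unitVec N μ)‖ + (a ^ 2 + ℓ) * ‖k x‖) ^ 2 := by
      have := sq_sum_le_card_mul_sum_sq (s := Finset.univ) (f := fun μ : Fin d => a * ‖Dirv N (fun (_ : Tor N) (_ : Fin d) => (1 : E →L[ℂ] E)) μ k x‖ + a * ‖Dirv N (fun (_ : Tor N) (_ : Fin d) => (1 : E →L[ℂ] E)) μ k (x - unitVec N μ)‖ + (a ^ 2 + ℓ) * ‖k x‖)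
      rwa [Finset.card_univ, hd] at this
    have h3 : ∀ μ, (a * ‖Dirv N (fun (_ : Tor N) (_ : Fin d) => (1 : E →L[ℂ] E)) μ k x‖ + a * ‖Dirv N (fun (_ : Tor N) (_ : Fin d) => (1 : E →L[ℂ] E)) μ k (x - unitVec N μ)‖ + (a ^ 2 + ℓ) * ‖k x‖) ^ 2
        ≤ 3 * (a ^ 2 * ‖Dirv N (fun (_ : Tor N) (_ : Fin d) => (1 : E →L[ℂ] E)) μ k x‖ ^ 2 + a ^ 2 * ‖Dirv N (fun (_ : Tor N) (_ : Fin d) => (1 : E →L[ℂ] E)) μ k (x - unitVec N μ)‖ ^ 2) + 3 * ((a ^ 2 + ℓ) ^ 2 * ‖k x‖ ^ 2) := by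
      intro μ
      nlinarith [sq_nonneg (a * ‖Dirv N (fun (_ : Tor N) (_ : Fin d) => (1 : E →L[ℂ] E)) μ k x‖ - a * ‖Dirv N (fun (_ : Tor N) (_ : Fin d) => (1 : E →L[ℂ] E)) μ k (x - unitVec N μ)‖), sq_nonneg (a * ‖Dirv N (fun (_ : Tor N) (_ : Fin d) => (1 : E →L[ℂ] E)) μ k x‖ - (a ^ 2 + ℓ) * ‖k x‖),
        sq_nonneg (a * ‖Dirv N (fun (_ : Tor N) (_ : Fin d) => (1 : E →L[ℂ] E)) μ k (x - unitVec N μ)‖ - (a ^ 2 + ℓ) * ‖k x‖)]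
    have h4 := sum_le_sum fun μ (_ : μ ∈ Finset.univ) => h3 μ
    rw [sum_add_distrib, ← mul_sum, sum_const, card_univ, Fintype.card_fin, nsmul_eq_mul] at h4
    have hd0 : (0 : ℝ) ≤ d := Nat.cast_nonneg d
    calc _ ≤ _ := h1.trans h2
      _ ≤ d * (3 * ∑ μ, (a ^ 2 * ‖Dirv N (fun (_ : Tor N) (_ : Fin d) => (1 : E →L[ℂ] E)) μ k x‖ ^ 2 + a ^ 2 * ‖Dirv N (fun (_ : Tor N) (_ : Fin d) => (1 : E →L[ℂ] E)) μ k (x - unitVec N μ)‖ ^ 2) + d * (3 * ((a ^ 2 + ℓ) ^ 2 * ‖k x‖ ^ 2))) :=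
          mul_le_mul_of_nonneg_left h4 hd0
      _ = _ := by ring
  -- sum over `x`, translation invariance for the shifted term
  have hshift : ∀ μ : Fin d, ∑ x, ‖Dirv N (fun (_ : Tor N) (_ : Fin d) => (1 : E →L[ℂ] E)) μ k (x - unitVec N μ)‖ ^ 2 = nsqv N (Dirv N (fun (_ : Tor N) (_ : Fin d) => (1 : E →L[ℂ] E)) μ k) := by
    intro μ
    have := sum_sq_translate N (Dirv N (fun (_ : Tor N) (_ : Fin d) => (1 : E →L[ℂ] E)) μ k) (-unitVec N μ)
    simp only [← sub_eq_add_neg] at this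
    exact this
  unfold nsqv
  calc ∑ x, ‖(negLapv N R k - negLapv N (fun (_ : Tor N) (_ : Fin d) => (1 : E →L[ℂ] E)) k) x‖ ^ 2
      ≤ ∑ x, (3 * d * ∑ μ, (a ^ 2 * ‖Dirv N (fun (_ : Tor N) (_ : Fin d) => (1 : E →L[ℂ] E)) μ k x‖ ^ 2 + a ^ 2 * ‖Dirv N (fun (_ : Tor N) (_ : Fin d) => (1 : E →L[ℂ] E)) μ k (x - unitVec N μ)‖ ^ 2) + 3 * (d : ℝ) ^ 2 * ((a ^ 2 + ℓ) ^ 2 * ‖k x‖ ^ 2)) :=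
        sum_le_sum fun x _ => hpt x
    _ = 3 * d * ∑ μ, (a ^ 2 * ∑ x, ‖Dirv N (fun (_ : Tor N) (_ : Fin d) => (1 : E →L[ℂ] E)) μ k x‖ ^ 2 + a ^ 2 * ∑ x, ‖Dirv N (fun (_ : Tor N) (_ : Fin d) => (1 : E →L[ℂ] E)) μ k (x - unitVec N μ)‖ ^ 2)
          + 3 * (d : ℝ) ^ 2 * (a ^ 2 + ℓ) ^ 2 * ∑ x, ‖k x‖ ^ 2 := by
        rw [sum_add_distrib, ← mul_sum, ← mul_sum, Finset.sum_comm, ← mul_sum]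
        congr 1
        · congr 1; refine sum_congr rfl fun μ _ => ?_; rw [sum_add_distrib, ← mul_sum, ← mul_sum]
        · ring
    _ = _ := by
        have e : ∀ μ : Fin d, a ^ 2 * ∑ x, ‖Dirv N (fun (_ : Tor N) (_ : Fin d) => (1 : E →L[ℂ] E)) μ k x‖ ^ 2 + a ^ 2 * ∑ x, ‖Dirv N (fun (_ : Tor N) (_ : Fin d) => (1 : E →L[ℂ] E)) μ k (x - unitVec N μ)‖ ^ 2 = 2 * a ^ 2 * ∑ x, ‖Dirv N (fun (_ : Tor N) (_ : Fin d) => (1 : E →L[ℂ] E)) μ k x‖ ^ 2 := by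
          intro μ; rw [hshift μ]; unfold nsqv; ring
        simp only [e, ← mul_sum]
        ring

end Pointwise

/-! ## §2 The relative bound on the block-mean-zero functions `K = ker Q′_1` -/

section Kernel

variable (n : ℕ) [NeZero n] (M : Fin d → ℕ) [hM : ∀ μ, NeZero (M μ)] [FiniteDimensional ℂ E]


/-- **block Poincaré on `ker Q′_1`** (leaf-09-g4's colour Poincaré at flat data): `nsqv k ≤ 4n²·Σ_μ nsqv (D¹_μ k)` for `Q′_1 k = 0`. [folklore] -/
theorem nsqv_le_dirichlet_of_ker {k : Tor (fine n M) → E} (hk : Qcv n M (fun _ => (1 : E →L[ℂ] E)) k = 0) :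
    nsqv (fine n M) k ≤ 4 * (n : ℝ) ^ 2 * ∑ μ, nsqv (fine n M) (Dirv (fine n M) (fun (_ : Tor (fine n M)) (_ : Fin d) => (1 : E →L[ℂ] E)) μ k) := by
  have hT : ∀ x : Tor (fine n M), (fun _ => (1 : E →L[ℂ] E)) x ∈ unitary (E →L[ℂ] E) := fun _ => Submonoid.one_mem _
  have hw' : ∀ (x : Tor (fine n M)) (μ : Fin d), blockOf n M (x + unitVec (fine n M) μ) = blockOf n M x →
      ‖((fun (_ : Tor (fine n M)) (_ : Fin d) => (1 : E →L[ℂ] E))) x μ * star ((fun _ => (1 : E →L[ℂ] E)) (x + unitVec (fine n M) μ)) * (fun _ => (1 : E →L[ℂ] E)) x - 1‖ ≤ (0 : ℝ) := by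
    intro x μ _; simp
  have hsmall : 2 * (d : ℝ) * ((n : ℝ) * 0) ^ 2 ≤ 1 / 2 := by norm_num
  have h := nsqv_le_colour_poincare_of_blockOf n M (R := (fun (_ : Tor (fine n M)) (_ : Fin d) => (1 : E →L[ℂ] E))) hT hw' hsmall k
  rw [hk] at h
  simp only [Pi.zero_apply, norm_zero, ne_eq, OfNat.ofNat_ne_zero, not_false_eq_true, zero_pow, sum_const_zero, mul_zero, zero_add] at h
  exact h

/-- on `ker Q′_1`: the flat Dirichlet form and the function are controlled by the flat Laplacian —
`Σ_μ nsqv (D¹_μ k) ≤ 4n²·nsqv (Δk)` and `nsqv k ≤ 16n⁴·nsqv (Δk)`. [folklore] -/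
theorem dirichlet_le_of_ker {k : Tor (fine n M) → E} (hk : Qcv n M (fun _ => (1 : E →L[ℂ] E)) k = 0) :
    ∑ μ, nsqv (fine n M) (Dirv (fine n M) (fun (_ : Tor (fine n M)) (_ : Fin d) => (1 : E →L[ℂ] E)) μ k) ≤ 4 * (n : ℝ) ^ 2 * nsqv (fine n M) (negLapv (fine n M) (fun (_ : Tor (fine n M)) (_ : Fin d) => (1 : E →L[ℂ] E)) k) ∧
    nsqv (fine n M) k ≤ 16 * (n : ℝ) ^ 4 * nsqv (fine n M) (negLapv (fine n M) (fun (_ : Tor (fine n M)) (_ : Fin d) => (1 : E →L[ℂ] E)) k) := by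
  set A := ∑ μ, nsqv (fine n M) (Dirv (fine n M) (fun (_ : Tor (fine n M)) (_ : Fin d) => (1 : E →L[ℂ] E)) μ k) with hA
  set U := nsqv (fine n M) k
  set L := nsqv (fine n M) (negLapv (fine n M) (fun (_ : Tor (fine n M)) (_ : Fin d) => (1 : E →L[ℂ] E)) k)
  have hA0 : 0 ≤ A := sum_nonneg fun μ _ => nsqv_nonneg _ _
  have hU0 : 0 ≤ U := nsqv_nonneg _ _
  have hL0 : 0 ≤ L := nsqv_nonneg _ _
  have hP : U ≤ 4 * (n : ℝ) ^ 2 * A := nsqv_le_dirichlet_of_ker n M hk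
  -- `A = Re⟪k, Δk⟫ ≤ √U √L`
  have h1 : A ≤ Real.sqrt U * Real.sqrt L := by rw [hA, sum_nsqv_Dirv_eq_re]; exact re_ipv_le (fine n M) k _
  -- `A ≤ √U·√L`, `U ≤ 4n²A` ⟹ `A ≤ 4n² L`
  have h2 : 1 * A ≤ 4 * (n : ℝ) ^ 2 * L := mul_le_of_sqrt_chain hA0 hU0 hL0 (by positivity) zero_le_one h1 (by linarith [hP])
  rw [one_mul] at h2
  exact ⟨h2, hP.trans (by nlinarith [h2])⟩

/-- **THE RELATIVE BOUND IN A REGULAR SMALL GAUGE**: unitary `R` with `‖R − 1‖ ≤ a` and longitudinal lattice-Lipschitz constant `‖R(x,μ) − R(x−e_μ,μ)‖ ≤ ℓ`;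
for every `k` with `Q′_1 k = 0`:  `nsqv ((div_R D_R − Δ) k) ≤ (24d·(n·a)² + 48d²·(n²·a² + n²·ℓ)²)·nsqv (Δ k)`  — i.e. `‖(div_R D_R − Δ)k‖ ≤ ε·‖Δk‖`
with `ε² = 24dα² + 48d²(α² + λ)²`, `α = na`, `λ = n²ℓ`, UNIFORM in `n`. [folklore] -/
theorem relBound_of_regular {R : Tor (fine n M) → Fin d → (E →L[ℂ] E)} (hU : ∀ x μ, R x μ ∈ unitary (E →L[ℂ] E)) {a ℓ : ℝ}
    (ha : ∀ x μ, ‖R x μ - 1‖ ≤ a) (hℓ : ∀ x μ, ‖R x μ - R (x - unitVec (fine n M) μ) μ‖ ≤ ℓ)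
    {k : Tor (fine n M) → E} (hk : Qcv n M (fun _ => (1 : E →L[ℂ] E)) k = 0) :
    nsqv (fine n M) (negLapv (fine n M) R k - negLapv (fine n M) (fun (_ : Tor (fine n M)) (_ : Fin d) => (1 : E →L[ℂ] E)) k)
      ≤ (24 * d * ((n : ℝ) * a) ^ 2 + 48 * (d : ℝ) ^ 2 * ((n : ℝ) ^ 2 * a ^ 2 + (n : ℝ) ^ 2 * ℓ) ^ 2) * nsqv (fine n M) (negLapv (fine n M) (fun (_ : Tor (fine n M)) (_ : Fin d) => (1 : E →L[ℂ] E)) k) := by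
  have h1 := nsqv_negLapv_sub_flat_le (fine n M) hU ha hℓ k
  obtain ⟨hA, hUk⟩ := dirichlet_le_of_ker n M hk
  have hL0 : 0 ≤ nsqv (fine n M) (negLapv (fine n M) (fun (_ : Tor (fine n M)) (_ : Fin d) => (1 : E →L[ℂ] E)) k) := nsqv_nonneg _ _
  have hd : (0 : ℝ) ≤ d := Nat.cast_nonneg d
  have t1 : 6 * d * a ^ 2 * ∑ μ, nsqv (fine n M) (Dirv (fine n M) (fun (_ : Tor (fine n M)) (_ : Fin d) => (1 : E →L[ℂ] E)) μ k) ≤ 6 * d * a ^ 2 * (4 * (n : ℝ) ^ 2 * nsqv (fine n M) (negLapv (fine n M) (fun (_ : Tor (fine n M)) (_ : Fin d) => (1 : E →L[ℂ] E)) k)) :=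
    mul_le_mul_of_nonneg_left hA (by positivity)
  have t2 : 3 * (d : ℝ) ^ 2 * (a ^ 2 + ℓ) ^ 2 * nsqv (fine n M) k ≤ 3 * (d : ℝ) ^ 2 * (a ^ 2 + ℓ) ^ 2 * (16 * (n : ℝ) ^ 4 * nsqv (fine n M) (negLapv (fine n M) (fun (_ : Tor (fine n M)) (_ : Fin d) => (1 : E →L[ℂ] E)) k)) :=
    mul_le_mul_of_nonneg_left hUk (by positivity)
  calc _ ≤ _ := h1
    _ ≤ 6 * d * a ^ 2 * (4 * (n : ℝ) ^ 2 * nsqv (fine n M) (negLapv (fine n M) (fun (_ : Tor (fine n M)) (_ : Fin d) => (1 : E →L[ℂ] E)) k))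
        + 3 * (d : ℝ) ^ 2 * (a ^ 2 + ℓ) ^ 2 * (16 * (n : ℝ) ^ 4 * nsqv (fine n M) (negLapv (fine n M) (fun (_ : Tor (fine n M)) (_ : Fin d) => (1 : E →L[ℂ] E)) k)) := add_le_add t1 t2
    _ = _ := by ring

end Kernel



end Summit.QuantumFields.BalabanUV.T4Continuum.RegularLaplacianRelativeBound

end
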